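import Literature.NumberTheory.Transcendental.FeldmanDeltaPolynomials
import Mathlib.Analysis.SpecificLimits.Basic
import HarnessLib

/-!
# Cell abc-stewartyu, WP-M3.F-odd (i′): the direction-`0` weights `ν(H)^m Δ^{(m)}(x; ℓ, H)/m!`

`Summits/ABC/StewartYu/FeldmanZeroDirectionWeights.lean` — cell `abc-stewartyu` (HOME
`run/shared/lean/pub/abc-stewartyu/`, seat p2-g4, rung A1.M3 = route `PadicPrimesKummerThird`,
crux `Y07Odd`; plain definitions and theorems, no named fact).  Companion of
`FeldmanDirectionalWeights.lean` (directions `1, …, n − 1`).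

In the direction of `Y₀` Nesterenko 2003 (LNM 1819) uses Fel'dman–Matveev's `Δ(Y₀; ℓ₀, H)`
((3.1), (3.22)) and normalises the `m₀`-th derivative of the equations by `d(m₀, H)/m₀!` ((3.30),
(3.34)): the weight `d(m₀,H) · Δ^{(m₀)}(2^{S−s}x; ℓ₀, H)/m₀!` is an INTEGER at integer points
(Prop. 3.1 (1)) of size controlled WITHOUT `m₀!` (Prop. 3.1 (2), Lemma 3.10).  The tree PROVES the
underlying lemma of Nesterenko–Waldschmidt 1996 (`Literature.NumberTheory.Transcendental.FeldmanDelta`: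
`num`, `den`, `den_dvd_lcmUpto_pow_mul_coeff_taylor`, `hasseDeriv_num_eval_le`) with the common
denominator `ν(H)^m`, `ν(H) = lcm(1, …, H)` (`Nat.lcmUpto`).  This file packages it in the shape the
Gen-3 frame consumes:

* `zeroWeight ℓ H m x = ν(H)^m · (taylor x num_ℤ).coeff m / den ℓ H ∈ ℤ` (exact division,
  `den_mul_zeroWeight`) and its value in a field of characteristic `0`
  (`cast_zeroWeight : ↑(zeroWeight …) = ν(H)^m · (hasseDeriv m num)(x) / den`);
* `map_num`, `coeff_taylor_num_intCast` (the numerator commutes with ring maps — the frame works in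
  `ℚ`, `ℚ_[p]`, `ℂ_p`);
* sizes: `hasse_num_eval_le_pow` (`(1/m!)|num^{(m)}(y)| ≤ (y + H)^ℓ`, all `m`, factorial-free),
  the sharp denominator bound `div_exp_pow_le_exp_mul_den` (`(H/e)^ℓ ≤ e^{H/e} · den ℓ H`, from
  `H! ≥ (H/e)^H` and `(H/e)^r/r! ≤ e^{H/e}`), hence Prop. 3.1 (2) at `t = 0`:
  `hasse_num_div_den_le : (hasseDeriv m num)(y)/den ≤ e^{H/e} (e(1 + y/H))^ℓ`, the integer-point form
  `abs_zeroWeight_le`, and the weighted `ℓ₀`-sum of Lemma 3.10 / (3.38)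
  (`sum_hasse_num_div_den_mul_pow_le : ∑_{ℓ ≤ L₀} (…)/den · G^{L₀−ℓ} ≤ 2e^{H/e} G^{L₀}` for
  `G ≥ 2e(1 + y/H)`).

WHAT THIS IS NOT: no crux moved; support arithmetic for the Gen-3 frame (`GenThreeEngineOdd`); the
bound `log ν(H) ≤ 1.04 H` ((3.2)) is the prime number theorem input and is NOT restated here (the
frame carries `ν(H)` as a parameter; `Chebyshev.psi_eq_log_lcmUpto` + the tree's `psi_le` bound it).

## References
* Yu. V. Nesterenko, *Linear forms in logarithms of rational numbers*, LNM 1819 (2003), §3.1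
  Prop. 3.1, §3.5 (3.30), (3.34), Lemma 3.10 (3.35)–(3.41). [Nesterenko2003]
* Yu. V. Nesterenko, M. Waldschmidt, Mat. Zapiski 2 (1996), §4 Lemma 4. [NesterenkoWaldschmidt1996]
-/

noncomputable section

open Finset Polynomial Real
open scoped Nat
open Literature.NumberTheory.Transcendental (FeldmanDelta.num FeldmanDelta.den)
open Literature.NumberTheory.Transcendental.FeldmanDelta

namespace Summit.ABC.StewartYu.DirWeights

/-! ### The numerator under ring maps -/

/-- `num` commutes with ring homomorphisms. [folklore] -/
theorem map_num {R S : Type*} [CommRing R] [CommRing S] (f : R →+* S) (ℓ H : ℕ) :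
    (num R ℓ H).map f = num S ℓ H := by
  unfold FeldmanDelta.num
  rw [Polynomial.map_prod]
  refine prod_congr rfl fun i _ => ?_
  rw [Polynomial.map_add, map_X, map_C, map_natCast]

/-- The Taylor coefficients of `num` at an integer commute with the cast `ℤ → K`. [folklore] -/
theorem coeff_taylor_num_intCast (K : Type*) [CommRing K] (ℓ H m : ℕ) (x : ℤ) :
    (((taylor x (num ℤ ℓ H)).coeff m : ℤ) : K) = (taylor (x : K) (num K ℓ H)).coeff m := by
  classical
  rcases Nat.lt_or_ge ℓ m with h | h
  · rw [coeff_taylor_num_eq_zero ℓ H x h, coeff_taylor_num_eq_zero ℓ H (x : K) h, Int.cast_zero]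
  · rw [coeff_taylor_num ℓ H x h, coeff_taylor_num ℓ H (x : K) h, Int.cast_sum]
    refine sum_congr rfl fun t _ => ?_
    rw [Int.cast_prod]
    refine prod_congr rfl fun i _ => ?_
    rw [Int.cast_add, Int.cast_natCast]

/-! ### The normalised integer weight -/

/-- **The direction-`0` weight** `ν(H)^m · Δ^{(m)}(x; ℓ, H)/m! = ν(H)^m (taylor x num).coeff m / den ℓ H`
as an integer (exact division for `H ≥ 1`, `den_mul_zeroWeight`).
[cite: Nesterenko2003, §3.1 Prop 3.1 (1), §3.5 (3.34)] -/
def zeroWeight (ℓ H m : ℕ) (x : ℤ) : ℤ :=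
  ((Nat.lcmUpto H : ℤ) ^ m * (taylor x (num ℤ ℓ H)).coeff m) / (den ℓ H : ℤ)

/-- **Integrality** (exact division): `den · zeroWeight = ν(H)^m (taylor x num).coeff m` for `H ≥ 1`.
[cite: Nesterenko2003, §3.1 Prop 3.1 (1)] [cite: NesterenkoWaldschmidt1996, §4 Lemma 4] -/
theorem den_mul_zeroWeight (ℓ : ℕ) {H : ℕ} (hH : 1 ≤ H) (m : ℕ) (x : ℤ) :
    (den ℓ H : ℤ) * zeroWeight ℓ H m x = (Nat.lcmUpto H : ℤ) ^ m * (taylor x (num ℤ ℓ H)).coeff m :=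
  Int.mul_ediv_cancel' (den_dvd_lcmUpto_pow_mul_coeff_taylor ℓ H hH le_rfl x)

/-- **The value in a field of characteristic `0`**:
`zeroWeight ℓ H m x = ν(H)^m · (hasseDeriv m num)(x) / den ℓ H`. [cite: Nesterenko2003, §3.5 (3.34)] -/
theorem cast_zeroWeight (K : Type*) [Field K] [CharZero K] (ℓ : ℕ) {H : ℕ} (hH : 1 ≤ H) (m : ℕ) (x : ℤ) :
    ((zeroWeight ℓ H m x : ℤ) : K) =
      (Nat.lcmUpto H : K) ^ m * (hasseDeriv m (num K ℓ H)).eval (x : K) / den ℓ H := by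
  have hden : (den ℓ H : K) ≠ 0 := by exact_mod_cast den_ne_zero ℓ H
  rw [eq_div_iff hden, hasseDeriv_num_eval, ← coeff_taylor_num_intCast K ℓ H m x]
  have h := congrArg (fun z : ℤ => (z : K)) (den_mul_zeroWeight ℓ hH m x)
  simp only [Int.cast_mul, Int.cast_pow, Int.cast_natCast] at h
  rw [mul_comm] at h
  exact h

/-! ### Sizes without `m!` -/

/-- `|(taylor x num_ℤ).coeff m| ≤ (taylor |x| num_ℝ).coeff m` (all factors `x + i % H` dominated by
`|x| + i % H`). [folklore] -/
theorem abs_coeff_taylor_num_le (ℓ H m : ℕ) (x : ℤ) :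
    |(((taylor x (num ℤ ℓ H)).coeff m : ℤ) : ℝ)| ≤ (taylor (|x| : ℝ) (num ℝ ℓ H)).coeff m := by
  classical
  rw [coeff_taylor_num_intCast ℝ ℓ H m x]
  rcases Nat.lt_or_ge ℓ m with h | h
  · rw [coeff_taylor_num_eq_zero ℓ H _ h, coeff_taylor_num_eq_zero ℓ H _ h, abs_zero]
  rw [coeff_taylor_num ℓ H _ h, coeff_taylor_num ℓ H _ h]
  refine (abs_sum_le_sum_abs _ _).trans (sum_le_sum fun t _ => ?_)
  rw [abs_prod]
  refine prod_le_prod (fun i _ => abs_nonneg _) fun i _ => ?_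
  exact (abs_add_le _ _).trans (by rw [Nat.abs_cast])

/-- **`(hasseDeriv m num)(y) ≤ (y + H)^ℓ`** for real `y ≥ 0`, `H ≥ 1`, every `m` (one term of
`∑ₖ C(ℓ,k)(y+H−1)^{ℓ−k} = (y+H)^ℓ`). [cite: Nesterenko2003, §3.1 Prop 3.1 (2), proof] -/
theorem hasse_num_eval_le_pow (ℓ : ℕ) {H : ℕ} (hH : 1 ≤ H) (m : ℕ) {y : ℝ} (hy : 0 ≤ y) :
    (hasseDeriv m (num ℝ ℓ H)).eval y ≤ (y + H) ^ ℓ := by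
  classical
  rcases Nat.lt_or_ge ℓ m with h | h
  · rw [hasseDeriv_num_eval, coeff_taylor_num_eq_zero ℓ H y h]
    positivity
  have hb : (0 : ℝ) ≤ y + H - 1 := by
    have : (1 : ℝ) ≤ H := by exact_mod_cast hH
    linarith
  refine (hasseDeriv_num_eval_le ℓ hH hy h).trans ?_
  have hsplit : (y + H) ^ ℓ = ((y + H - 1) + 1) ^ ℓ := by ring_nf
  rw [hsplit, add_pow]
  have hmem : m ∈ range (ℓ + 1) := mem_range.mpr (Nat.lt_succ_of_le h)
  refine le_trans (le_of_eq ?_) (single_le_sum (f := fun k => (y + H - 1) ^ k * 1 ^ (ℓ - k) *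
    (ℓ.choose k : ℝ)) (fun k _ => by positivity) (mem_range.mpr (Nat.lt_succ_of_le (Nat.sub_le ℓ m))))
  rw [one_pow, mul_one, Nat.choose_symm h, mul_comm]

/-- **The sharp denominator bound** `(H/e)^ℓ ≤ e^{H/e} · den ℓ H` (`H ≥ 1`): with `ℓ = qH + r`,
`den = (H!)^q r!`, `(H/e)^H ≤ H!` and `(H/e)^r ≤ e^{H/e} r!`.
[cite: Nesterenko2003, §3.1 Prop 3.1 (2), proof ("`H! ≥ H^H e^{−H+1}`")] -/
theorem div_exp_pow_le_exp_mul_den (ℓ : ℕ) {H : ℕ} (hH : 1 ≤ H) :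
    ((H : ℝ) / exp 1) ^ ℓ ≤ exp (H / exp 1) * den ℓ H := by
  set q := ℓ / H with hq
  set r := ℓ % H with hr
  have hN : H * q + r = ℓ := Nat.div_add_mod ℓ H
  have hHe : (0 : ℝ) ≤ H / exp 1 := by positivity
  have hfH : (0 : ℝ) < (H ! : ℝ) := by exact_mod_cast Nat.factorial_pos H
  have hfr : (0 : ℝ) < (r ! : ℝ) := by exact_mod_cast Nat.factorial_pos r
  -- `(H/e)^H ≤ H!`
  have h1 : ((H : ℝ) / exp 1) ^ H ≤ H ! := by
    have h := Real.pow_div_factorial_le_exp (H : ℝ) (Nat.cast_nonneg H) H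
    rw [div_le_iff₀ hfH] at h
    rw [div_pow, ← Real.exp_nat_mul, mul_one, div_le_iff₀ (exp_pos _), mul_comm]
    exact h
  -- `(H/e)^r ≤ e^{H/e} r!`
  have h2 : ((H : ℝ) / exp 1) ^ r ≤ exp (H / exp 1) * r ! := by
    have h := Real.pow_div_factorial_le_exp ((H : ℝ) / exp 1) hHe r
    rwa [div_le_iff₀ hfr] at h
  rw [den_eq ℓ hH]
  push_cast
  calc ((H : ℝ) / exp 1) ^ ℓ = (((H : ℝ) / exp 1) ^ H) ^ q * ((H : ℝ) / exp 1) ^ r := by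
        rw [← pow_mul, ← pow_add, hN]
    _ ≤ (H ! : ℝ) ^ q * (exp (H / exp 1) * r !) := by gcongr
    _ = exp (H / exp 1) * ((H ! : ℝ) ^ q * r !) := by ring

/-- **Prop. 3.1 (2) at `t = 0`**: `(hasseDeriv m num)(y)/den ℓ H ≤ e^{H/e} · (e(1 + y/H))^ℓ` for real
`y ≥ 0`, `H ≥ 1`, every `m` (no `m!`, no `ℓ!`). [cite: Nesterenko2003, §3.1 Prop 3.1 (2)] -/
theorem hasse_num_div_den_le (ℓ : ℕ) {H : ℕ} (hH : 1 ≤ H) (m : ℕ) {y : ℝ} (hy : 0 ≤ y) :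
    (hasseDeriv m (num ℝ ℓ H)).eval y / den ℓ H ≤ exp (H / exp 1) * (exp 1 * (1 + y / H)) ^ ℓ := by
  have hden : (0 : ℝ) < den ℓ H := by exact_mod_cast den_pos ℓ H
  have hH0 : (0 : ℝ) < H := by exact_mod_cast hH
  have hkey : (y + H) ^ ℓ = ((H : ℝ) / exp 1) ^ ℓ * (exp 1 * (1 + y / H)) ^ ℓ := by
    rw [← mul_pow]
    congr 1
    field_simp
    ring
  rw [div_le_iff₀ hden]
  calc (hasseDeriv m (num ℝ ℓ H)).eval y ≤ (y + H) ^ ℓ := hasse_num_eval_le_pow ℓ hH m hy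
    _ = ((H : ℝ) / exp 1) ^ ℓ * (exp 1 * (1 + y / H)) ^ ℓ := hkey
    _ ≤ (exp (H / exp 1) * den ℓ H) * (exp 1 * (1 + y / H)) ^ ℓ :=
        mul_le_mul_of_nonneg_right (div_exp_pow_le_exp_mul_den ℓ hH) (by positivity)
    _ = exp (H / exp 1) * (exp 1 * (1 + y / H)) ^ ℓ * den ℓ H := by ring

/-- **Size of the integer weight**: `|zeroWeight ℓ H m x| ≤ ν(H)^m · e^{H/e} · (e(1 + |x|/H))^ℓ`.
[cite: Nesterenko2003, §3.1 Prop 3.1, §3.5 Lemma 3.10 (3.37)–(3.39)] -/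
theorem abs_zeroWeight_le (ℓ : ℕ) {H : ℕ} (hH : 1 ≤ H) (m : ℕ) (x : ℤ) :
    |((zeroWeight ℓ H m x : ℤ) : ℝ)| ≤
      (Nat.lcmUpto H : ℝ) ^ m * (exp (H / exp 1) * (exp 1 * (1 + |(x : ℝ)| / H)) ^ ℓ) := by
  have hden : (0 : ℝ) < den ℓ H := by exact_mod_cast den_pos ℓ H
  have hx0 : (0 : ℝ) ≤ |(x : ℝ)| := abs_nonneg _
  -- `|den · w| = ν^m |coeff| ≤ ν^m (taylor |x| num_ℝ).coeff m = ν^m (hasse m num_ℝ)(|x|)`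
  have h := congrArg (fun z : ℤ => (z : ℝ)) (den_mul_zeroWeight ℓ hH m x)
  simp only [Int.cast_mul, Int.cast_pow, Int.cast_natCast] at h
  have habs : (den ℓ H : ℝ) * |((zeroWeight ℓ H m x : ℤ) : ℝ)| ≤
      (Nat.lcmUpto H : ℝ) ^ m * (hasseDeriv m (num ℝ ℓ H)).eval (|(x : ℝ)|) := by
    rw [← abs_of_pos hden, ← abs_mul, h, abs_mul, abs_pow, Nat.abs_cast, hasseDeriv_num_eval]
    exact mul_le_mul_of_nonneg_left (abs_coeff_taylor_num_le ℓ H m x) (by positivity)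
  have habs' : |((zeroWeight ℓ H m x : ℤ) : ℝ)| ≤
      (Nat.lcmUpto H : ℝ) ^ m * ((hasseDeriv m (num ℝ ℓ H)).eval (|(x : ℝ)|) / den ℓ H) := by
    rw [← mul_div_assoc, le_div_iff₀' hden]
    exact habs
  refine habs'.trans ?_
  exact mul_le_mul_of_nonneg_left (hasse_num_div_den_le ℓ hH m hx0) (by positivity)

/-- **The weighted `ℓ₀`-sum of Lemma 3.10 / (3.38)**: for `G ≥ 2e(1 + y/H)`,
`∑_{ℓ ≤ L₀} (hasseDeriv m num_{ℓ,H})(y)/den ℓ H · G^{L₀−ℓ} ≤ 2 e^{H/e} G^{L₀}`.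
[cite: Nesterenko2003, §3.5 Lemma 3.10 (3.35), (3.38)–(3.39)] -/
theorem sum_hasse_num_div_den_mul_pow_le {H : ℕ} (hH : 1 ≤ H) (m : ℕ) {y : ℝ} (hy : 0 ≤ y) {G : ℝ}
    (hG : 2 * (exp 1 * (1 + y / H)) ≤ G) (L₀ : ℕ) :
    ∑ ℓ ∈ range (L₀ + 1), (hasseDeriv m (num ℝ ℓ H)).eval y / den ℓ H * G ^ (L₀ - ℓ) ≤
      2 * exp (H / exp 1) * G ^ L₀ := by
  set ρ : ℝ := exp 1 * (1 + y / H) with hρ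
  have hρ0 : 0 ≤ ρ := by positivity
  have hG0 : 0 ≤ G := le_trans (by positivity) hG
  have hρG : ρ ≤ G / 2 := by linarith
  have hterm : ∀ ℓ ∈ range (L₀ + 1),
      (hasseDeriv m (num ℝ ℓ H)).eval y / den ℓ H * G ^ (L₀ - ℓ) ≤
        exp (H / exp 1) * G ^ L₀ * (1 / 2) ^ ℓ := by
    intro ℓ hℓ
    have hℓ' : ℓ ≤ L₀ := Nat.lt_succ_iff.mp (mem_range.mp hℓ)
    calc (hasseDeriv m (num ℝ ℓ H)).eval y / den ℓ H * G ^ (L₀ - ℓ)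
        ≤ (exp (H / exp 1) * ρ ^ ℓ) * G ^ (L₀ - ℓ) :=
          mul_le_mul_of_nonneg_right (hasse_num_div_den_le ℓ hH m hy) (by positivity)
      _ ≤ (exp (H / exp 1) * (G / 2) ^ ℓ) * G ^ (L₀ - ℓ) := by gcongr
      _ = exp (H / exp 1) * G ^ L₀ * (1 / 2) ^ ℓ := by
          rw [div_eq_mul_one_div G 2, mul_pow,
            show G ^ L₀ = G ^ ℓ * G ^ (L₀ - ℓ) by rw [← pow_add, Nat.add_sub_cancel' hℓ']]
          ring
  calc ∑ ℓ ∈ range (L₀ + 1), (hasseDeriv m (num ℝ ℓ H)).eval y / den ℓ H * G ^ (L₀ - ℓ)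
      ≤ ∑ ℓ ∈ range (L₀ + 1), exp (H / exp 1) * G ^ L₀ * (1 / 2) ^ ℓ := sum_le_sum hterm
    _ = exp (H / exp 1) * G ^ L₀ * ∑ ℓ ∈ range (L₀ + 1), (1 / 2 : ℝ) ^ ℓ := by rw [mul_sum]
    _ ≤ exp (H / exp 1) * G ^ L₀ * 2 :=
        mul_le_mul_of_nonneg_left (sum_geometric_two_le _) (by positivity)
    _ = 2 * exp (H / exp 1) * G ^ L₀ := by ring

/-- **The integer-point form of the `ℓ₀`-sum** (the factor `E · Σ` of (3.35) in direction `0`): for an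
integer `x` and `G ≥ 2e(1 + |x|/H)`,
`∑_{ℓ ≤ L₀} |zeroWeight ℓ H m x| · G^{L₀−ℓ} ≤ ν(H)^m · 2e^{H/e} · G^{L₀}`.
[cite: Nesterenko2003, §3.5 Lemma 3.10 (3.35)–(3.39)] -/
theorem sum_abs_zeroWeight_mul_pow_le {H : ℕ} (hH : 1 ≤ H) (m : ℕ) (x : ℤ) {G : ℝ}
    (hG : 2 * (exp 1 * (1 + |(x : ℝ)| / H)) ≤ G) (L₀ : ℕ) :
    ∑ ℓ ∈ range (L₀ + 1), |((zeroWeight ℓ H m x : ℤ) : ℝ)| * G ^ (L₀ - ℓ) ≤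
      (Nat.lcmUpto H : ℝ) ^ m * (2 * exp (H / exp 1) * G ^ L₀) := by
  have hden : ∀ ℓ, (0 : ℝ) < den ℓ H := fun ℓ => by exact_mod_cast den_pos ℓ H
  have hx0 : (0 : ℝ) ≤ |(x : ℝ)| := abs_nonneg _
  have hG0 : 0 ≤ G := le_trans (by positivity) hG
  have hterm : ∀ ℓ ∈ range (L₀ + 1), |((zeroWeight ℓ H m x : ℤ) : ℝ)| * G ^ (L₀ - ℓ) ≤
      (Nat.lcmUpto H : ℝ) ^ m *
        ((hasseDeriv m (num ℝ ℓ H)).eval (|(x : ℝ)|) / den ℓ H * G ^ (L₀ - ℓ)) := by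
    intro ℓ _
    have h := congrArg (fun z : ℤ => (z : ℝ)) (den_mul_zeroWeight ℓ hH m x)
    simp only [Int.cast_mul, Int.cast_pow, Int.cast_natCast] at h
    have habs : (den ℓ H : ℝ) * |((zeroWeight ℓ H m x : ℤ) : ℝ)| ≤
        (Nat.lcmUpto H : ℝ) ^ m * (hasseDeriv m (num ℝ ℓ H)).eval (|(x : ℝ)|) := by
      rw [← abs_of_pos (hden ℓ), ← abs_mul, h, abs_mul, abs_pow, Nat.abs_cast, hasseDeriv_num_eval]
      exact mul_le_mul_of_nonneg_left (abs_coeff_taylor_num_le ℓ H m x) (by positivity)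
    replace habs : |((zeroWeight ℓ H m x : ℤ) : ℝ)| ≤
        (Nat.lcmUpto H : ℝ) ^ m * ((hasseDeriv m (num ℝ ℓ H)).eval (|(x : ℝ)|) / den ℓ H) := by
      rw [← mul_div_assoc, le_div_iff₀' (hden ℓ)]
      exact habs
    calc |((zeroWeight ℓ H m x : ℤ) : ℝ)| * G ^ (L₀ - ℓ)
        ≤ ((Nat.lcmUpto H : ℝ) ^ m * ((hasseDeriv m (num ℝ ℓ H)).eval (|(x : ℝ)|) / den ℓ H)) *
            G ^ (L₀ - ℓ) := mul_le_mul_of_nonneg_right habs (by positivity)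
      _ = _ := by ring
  refine (sum_le_sum hterm).trans ?_
  rw [← mul_sum]
  exact mul_le_mul_of_nonneg_left (sum_hasse_num_div_den_mul_pow_le hH m hx0 hG L₀) (by positivity)

end Summit.ABC.StewartYu.DirWeights

end
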